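import Literature.Analysis.FluidPDE.TypeIAncientMild
import Literature.Analysis.FluidPDE.NormalisedPressureFarField
import Literature.Analysis.FluidPDE.TaoEnergyLocalisationPressure
import HarnessLib

/-!
# Crux `ClockStretchingLaw.ClockLaw` (stmt-NavierStokesRegularity-10571), line `registered`:
# tools for `stub_pressureRepr` — dyadic shells, far-field pressure integrals, bookkeeping

Helper file (theorems only) for the stub `stub_pressureRepr` of the birth line of the crux
`ClockLaw` (the pressure of a Type-I KNSS-mild model on the cylinder `Q(0,2)`). Contents:

* `pressureRepr_integrableOn_of_norm_le_mul` — `|f| ≤ M |g|` on `S` with `g` continuous of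
  compact support and `f` measurable on `S` gives `f ∈ L¹(S)`;
* `pressureRepr_morrey_of_ledger` — the `A`-part of the route's energy ledger in Morrey form:
  `∫_{B(x₀,r)} ‖u(t)‖² ≤ C r` for every `t < 0`, `x₀`, `r > 0`;
* `pressureRepr_lintegral_shell_le` — the dyadic-shell computation
  `∫_{‖y-x₀‖ ≥ a} ‖y-x₀‖⁻³ ‖v‖² ≤ 4 I / a²` under the Morrey bound `∫_{B(x₀,r)} ‖v‖² ≤ I r`;
* `pressureRepr_farPressure_integrable`, `pressureRepr_abs_farPressure_le` (closed form:
  `pressureRepr_farPressure_bound`) — absolute convergence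
  and the bound `|∫ g(y) K(x-y)(v y) dy| ≤ 16 I/(π a²)` for the Riesz pressure kernel
  `K(z)(a) = (3⟨z,a⟩² - |a|²|z|²)/(4π|z|⁵)` against a weight `|g| ≤ 1` vanishing on `B(0,a)`,
  `2‖x‖ ≤ a` (the far-field pressure of a field with scale-invariant energy);
* `pressureRepr_pressureSource_congr` — locality of the quadratic source `∂ᵢ∂ⱼ(vᵢvⱼ)`.
-/

noncomputable section

open MeasureTheory Filter Topology Set Metric Function
open Literature.Analysis Literature.Analysis.FluidPDE
open scoped Topology NNReal ENNReal InnerProductSpace RealInnerProductSpace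

-- Summit = Problem namespace duplication is the tree's layout (CONVENTIONS §1); as in every Theorems file.
set_option linter.dupNamespace false

namespace Summit.NavierStokesRegularity.NavierStokesRegularity.Theorems.ClockLaw.Birth

/-- Local notation: `ℝ³`. -/
local notation "E3" => EuclideanSpace ℝ (Fin 3)

/-! ### Integrability bookkeeping -/

section Integrable

variable {Z : Type*} [MeasurableSpace Z] [TopologicalSpace Z] [OpensMeasurableSpace Z]
  {μ : Measure Z} [IsFiniteMeasureOnCompacts μ]
  {W : Type*} [NormedAddCommGroup W]

/-- `|f| ≤ M ‖g‖` on `S`, with `g` continuous of compact support and `f` a.e. strongly measurable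
on `S`, gives `f ∈ L¹(S)`. [folklore] -/
theorem pressureRepr_integrableOn_of_norm_le_mul {S : Set Z} (hS : MeasurableSet S) {f : Z → ℝ}
    {g : Z → W} {M : ℝ} (hf : AEStronglyMeasurable f (μ.restrict S)) (hg : Continuous g)
    (hgc : HasCompactSupport g) (hle : ∀ z ∈ S, ‖f z‖ ≤ M * ‖g z‖) : IntegrableOn f S μ := by
  have hgi : Integrable (fun z => M * ‖g z‖) μ :=
    ((hg.norm).integrable_of_hasCompactSupport hgc.norm).const_mul M
  refine Integrable.mono' hgi.integrableOn hf ?_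
  exact (ae_restrict_iff' hS).2 (Eventually.of_forall hle)

end Integrable

/-! ### The energy ledger in Morrey form -/

/-- **The `A`-part of the energy ledger in Morrey form**: `∫_{B(x₀,r)} ‖u(t)‖² ≤ C r` for every
`t < 0`, `x₀`, `r > 0` (choose the vertex `t₀ = min 0 (t + r²/2)`, so that `t₀ - r² < t < t₀ ≤ 0`).
[folklore] -/
theorem pressureRepr_morrey_of_ledger {C : ℝ} {u : ℝ → E3 → E3}
    (hE : ∀ (x₀ : EuclideanSpace ℝ (Fin 3)) (t₀ r : ℝ), t₀ ≤ 0 → 0 < r →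
      (∀ t, t₀ - r ^ 2 < t → t < t₀ → r⁻¹ * ∫ x in Metric.ball x₀ r, ‖u t x‖ ^ 2 ≤ C) ∧
        r⁻¹ * ∫ t in Set.Ioo (t₀ - r ^ 2) t₀, ∫ x in Metric.ball x₀ r, ‖fderiv ℝ (u t) x‖ ^ 2 ≤ C)
    {t : ℝ} (ht : t < 0) (x₀ : E3) {r : ℝ} (hr : 0 < r) :
    ∫ x in ball x₀ r, ‖u t x‖ ^ 2 ≤ C * r := by
  set t₀ : ℝ := min 0 (t + r ^ 2 / 2) with ht₀
  have h0 : t₀ ≤ 0 := min_le_left _ _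
  have h1 : t₀ - r ^ 2 < t := by
    have : t₀ ≤ t + r ^ 2 / 2 := min_le_right _ _
    nlinarith
  have h2 : t < t₀ := by
    simp only [ht₀, lt_min_iff]
    exact ⟨ht, by nlinarith⟩
  have key := ((hE x₀ t₀ r h0 hr).1 t h1 h2)
  rw [inv_mul_le_iff₀ hr] at key
  linarith

/-! ### Dyadic shells -/

/-- **The dyadic-shell bound.** If `∫⁻_{B(x₀,r)} ‖v‖² ≤ I r` for all `r > 0` (`I ≥ 0`), then for
`a > 0`, `∫⁻_{‖y-x₀‖ ≥ a} ‖y-x₀‖⁻³ ‖v y‖² dy ≤ 4 I / a²`: on the shell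
`a 2^k ≤ ‖y-x₀‖ < a 2^{k+1}` the weight is at most `(a 2^k)⁻³` and the mass at most `I a 2^{k+1}`,
so the shell contributes `≤ (2I/a²) 4^{-k} ≤ (2I/a²) 2^{-k}`. [folklore] -/
theorem pressureRepr_lintegral_shell_le {v : E3 → E3} {x₀ : E3} {I a : ℝ} (hI : 0 ≤ I)
    (ha : 0 < a)
    (hv : ∀ r > 0, ∫⁻ y in ball x₀ r, ENNReal.ofReal (‖v y‖ ^ 2) ≤ ENNReal.ofReal (I * r)) :
    ∫⁻ y in {y | a ≤ ‖y - x₀‖}, ENNReal.ofReal ((‖y - x₀‖ ^ 3)⁻¹ * ‖v y‖ ^ 2) ≤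
      ENNReal.ofReal (4 * I / a ^ 2) := by
  set r : ℕ → ℝ := fun k => a * 2 ^ k with hr
  have hr0 : ∀ k, 0 < r k := fun k => by positivity
  -- the dyadic shells around `x₀`
  set A : ℕ → Set E3 := fun k => {y | r k ≤ ‖y - x₀‖ ∧ ‖y - x₀‖ < r (k + 1)} with hA
  have hc : Continuous fun y : E3 => ‖y - x₀‖ := by fun_prop
  have hAm : ∀ k, MeasurableSet (A k) := fun k =>
    (isClosed_le continuous_const hc).measurableSet.inter
      (isOpen_lt hc continuous_const).measurableSet
  have hcover : {y : E3 | a ≤ ‖y - x₀‖} ⊆ ⋃ k, A k := by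
    intro y hy
    have hy1 : 1 ≤ ‖y - x₀‖ / a := by rw [le_div_iff₀ ha, one_mul]; exact hy
    obtain ⟨n, hn1, hn2⟩ := exists_nat_pow_near hy1 one_lt_two
    refine mem_iUnion.2 ⟨n, ?_, ?_⟩
    · show a * 2 ^ n ≤ ‖y - x₀‖
      rw [mul_comm, ← le_div_iff₀ ha]; exact hn1
    · show ‖y - x₀‖ < a * 2 ^ (n + 1)
      rw [mul_comm, ← div_lt_iff₀ ha]; exact hn2
  have hAball : ∀ k, A k ⊆ ball x₀ (r (k + 1)) := fun k y hy => by
    rw [mem_ball, dist_eq_norm]; exact hy.2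
  -- pointwise bound on the `k`-th shell
  have hpt : ∀ k, ∀ y ∈ A k, ENNReal.ofReal ((‖y - x₀‖ ^ 3)⁻¹ * ‖v y‖ ^ 2) ≤
      ENNReal.ofReal ((r k ^ 3)⁻¹) * ENNReal.ofReal (‖v y‖ ^ 2) := by
    intro k y hy
    rw [← ENNReal.ofReal_mul (by positivity)]
    refine ENNReal.ofReal_le_ofReal ?_
    have h1 : (‖y - x₀‖ ^ 3)⁻¹ ≤ (r k ^ 3)⁻¹ := by
      refine inv_anti₀ (by positivity) ?_
      exact pow_le_pow_left₀ (hr0 k).le hy.1 3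
    exact mul_le_mul_of_nonneg_right h1 (by positivity)
  -- the shell integrals
  have hshell : ∀ k, ∫⁻ y in A k, ENNReal.ofReal ((‖y - x₀‖ ^ 3)⁻¹ * ‖v y‖ ^ 2) ≤
      ENNReal.ofReal (2 * I / a ^ 2 * (1 / 2) ^ k) := by
    intro k
    calc ∫⁻ y in A k, ENNReal.ofReal ((‖y - x₀‖ ^ 3)⁻¹ * ‖v y‖ ^ 2)
        ≤ ∫⁻ y in A k, ENNReal.ofReal ((r k ^ 3)⁻¹) * ENNReal.ofReal (‖v y‖ ^ 2) :=
          setLIntegral_mono' (hAm k) (hpt k)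
      _ = ENNReal.ofReal ((r k ^ 3)⁻¹) * ∫⁻ y in A k, ENNReal.ofReal (‖v y‖ ^ 2) :=
          lintegral_const_mul' _ _ ENNReal.ofReal_ne_top
      _ ≤ ENNReal.ofReal ((r k ^ 3)⁻¹) * ∫⁻ y in ball x₀ (r (k + 1)), ENNReal.ofReal (‖v y‖ ^ 2) :=
          mul_le_mul_right (lintegral_mono_set (hAball k)) _
      _ ≤ ENNReal.ofReal ((r k ^ 3)⁻¹) * ENNReal.ofReal (I * r (k + 1)) :=
          mul_le_mul_right (hv _ (hr0 (k + 1))) _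
      _ = ENNReal.ofReal (2 * I / a ^ 2 * (1 / 4) ^ k) := by
          rw [← ENNReal.ofReal_mul (by positivity)]
          congr 1
          simp only [hr, one_div_pow, pow_succ, mul_pow]
          have h4 : (4 : ℝ) ^ k = 2 ^ k * 2 ^ k := by
            rw [show (4 : ℝ) = 2 * 2 by norm_num, mul_pow]
          rw [h4]
          field_simp
      _ ≤ ENNReal.ofReal (2 * I / a ^ 2 * (1 / 2) ^ k) := by
          refine ENNReal.ofReal_le_ofReal (mul_le_mul_of_nonneg_left ?_ (by positivity))
          exact pow_le_pow_left₀ (by norm_num) (by norm_num) k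
  calc ∫⁻ y in {y | a ≤ ‖y - x₀‖}, ENNReal.ofReal ((‖y - x₀‖ ^ 3)⁻¹ * ‖v y‖ ^ 2)
      ≤ ∫⁻ y in ⋃ k, A k, ENNReal.ofReal ((‖y - x₀‖ ^ 3)⁻¹ * ‖v y‖ ^ 2) :=
        lintegral_mono_set hcover
    _ ≤ ∑' k, ∫⁻ y in A k, ENNReal.ofReal ((‖y - x₀‖ ^ 3)⁻¹ * ‖v y‖ ^ 2) :=
        lintegral_iUnion_le _ _
    _ ≤ ∑' k : ℕ, ENNReal.ofReal (2 * I / a ^ 2 * (1 / 2) ^ k) := ENNReal.tsum_le_tsum hshell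
    _ = ENNReal.ofReal (∑' k : ℕ, 2 * I / a ^ 2 * (1 / 2) ^ k) :=
        (ENNReal.ofReal_tsum_of_nonneg (fun k => by positivity)
          (summable_geometric_two.mul_left _)).symm
    _ = ENNReal.ofReal (4 * I / a ^ 2) := by
        rw [tsum_mul_left, tsum_geometric_two]; ring_nf

/-! ### The far-field pressure integral -/

section FarPressure

variable {v : E3 → E3} {g : E3 → ℝ} {I a : ℝ} {x : E3}

/-- The pointwise bound behind the far-field pressure integral: for `|g| ≤ 1` vanishing on
`B(0,a)` and `2‖x‖ ≤ a`, `|g(y) K(x-y)(v y)| ≤ (4/π) 1_{‖y‖ ≥ a} ‖y‖⁻³ ‖v y‖²`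
(`|K(z)(b)| ≤ |b|²/(2π|z|³)` and `‖x - y‖ ≥ ‖y‖/2`). [folklore] -/
theorem pressureRepr_abs_farPressure_integrand_le (hg1 : ∀ y, |g y| ≤ 1) (ha : 0 < a)
    (hg0 : ∀ y, ‖y‖ < a → g y = 0) (hx : 2 * ‖x‖ ≤ a) (y : E3) :
    |g y * pressureKernel (x - y) (v y)| ≤
      (4 / Real.pi) * ({y : E3 | a ≤ ‖y - 0‖}.indicator
        (fun y => (‖y - 0‖ ^ 3)⁻¹ * ‖v y‖ ^ 2) y) := by
  by_cases hy : ‖y‖ < a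
  · rw [hg0 y hy, zero_mul, abs_zero]
    exact mul_nonneg (by positivity) (indicator_nonneg (fun _ _ => by positivity) _)
  · rw [not_lt] at hy
    have hmem : y ∈ {y : E3 | a ≤ ‖y - 0‖} := by simpa using hy
    rw [indicator_of_mem hmem, sub_zero]
    have hy0 : 0 < ‖y‖ := ha.trans_le hy
    have hxy : ‖y‖ / 2 ≤ ‖x - y‖ := by
      have := norm_sub_norm_le y x
      rw [norm_sub_rev] at this
      linarith
    have hxy0 : 0 < ‖x - y‖ := lt_of_lt_of_le (by positivity) hxy
    calc |g y * pressureKernel (x - y) (v y)| = |g y| * |pressureKernel (x - y) (v y)| := abs_mul _ _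
      _ ≤ 1 * (‖v y‖ ^ 2 / (2 * Real.pi * ‖x - y‖ ^ 3)) :=
          mul_le_mul (hg1 y) (abs_pressureKernel_le _ _) (abs_nonneg _) zero_le_one
      _ ≤ 1 * (‖v y‖ ^ 2 / (2 * Real.pi * (‖y‖ / 2) ^ 3)) := by
          gcongr
      _ = (4 / Real.pi) * ((‖y‖ ^ 3)⁻¹ * ‖v y‖ ^ 2) := by
          field_simp
          ring

/-- Measurability of the far-field pressure integrand for continuous `g`, `v`. [folklore] -/
theorem pressureRepr_aestronglyMeasurable_farPressure_integrand (hg : Continuous g)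
    (hv : Continuous v) (x : E3) :
    AEStronglyMeasurable (fun y => g y * pressureKernel (x - y) (v y)) volume := by
  have h3 : Measurable fun y : E3 => (x - y, v y) :=
    (measurable_const.sub measurable_id).prodMk hv.measurable
  exact (hg.measurable.mul (measurable_pressureKernel.comp h3)).aestronglyMeasurable

/-- The Morrey hypothesis in `∫⁻` form for a continuous field. [folklore] -/
theorem pressureRepr_lintegral_ball_le_of_integral (hv : Continuous v) (x₀ : E3)
    (hMor : ∀ r > 0, ∫ y in ball x₀ r, ‖v y‖ ^ 2 ≤ I * r) (r : ℝ) (hr : 0 < r) :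
    ∫⁻ y in ball x₀ r, ENNReal.ofReal (‖v y‖ ^ 2) ≤ ENNReal.ofReal (I * r) := by
  have hint : IntegrableOn (fun y => ‖v y‖ ^ 2) (ball x₀ r) :=
    (((hv.norm).pow 2).continuousOn.integrableOn_compact (isCompact_closedBall x₀ r)).mono_set
      ball_subset_closedBall
  rw [← ofReal_integral_eq_lintegral_ofReal hint (Eventually.of_forall fun y => by positivity)]
  exact ENNReal.ofReal_le_ofReal (hMor r hr)

/-- **The far-field pressure integral converges absolutely and is `O(I/a²)`**: for `v` continuous
with `∫_{B(0,r)} ‖v‖² ≤ I r` (`r > 0`), `g` continuous with `|g| ≤ 1` vanishing on `B(0,a)`, and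
`2‖x‖ ≤ a`, the `∫⁻` of `|g(y) K(x-y)(v y)|` is at most `16 I/(π a²)`. [folklore] -/
theorem pressureRepr_lintegral_farPressure_le (hv : Continuous v) (hI : 0 ≤ I)
    (hMor : ∀ r > 0, ∫ y in ball (0 : E3) r, ‖v y‖ ^ 2 ≤ I * r) (hg1 : ∀ y, |g y| ≤ 1)
    (ha : 0 < a) (hg0 : ∀ y, ‖y‖ < a → g y = 0) (hx : 2 * ‖x‖ ≤ a) :
    ∫⁻ y, ‖g y * pressureKernel (x - y) (v y)‖ₑ ≤ ENNReal.ofReal (16 * I / (Real.pi * a ^ 2)) := by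
  have hS : MeasurableSet {y : E3 | a ≤ ‖y - 0‖} :=
    (isClosed_le continuous_const (by fun_prop)).measurableSet
  have hshell := pressureRepr_lintegral_shell_le (x₀ := (0 : E3)) hI ha
    (pressureRepr_lintegral_ball_le_of_integral hv 0 hMor)
  calc ∫⁻ y, ‖g y * pressureKernel (x - y) (v y)‖ₑ
      ≤ ∫⁻ y, ENNReal.ofReal ((4 / Real.pi) * ({y : E3 | a ≤ ‖y - 0‖}.indicator
          (fun y => (‖y - 0‖ ^ 3)⁻¹ * ‖v y‖ ^ 2) y)) := by
        refine lintegral_mono fun y => ?_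
        rw [← ofReal_norm, Real.norm_eq_abs]
        exact ENNReal.ofReal_le_ofReal (pressureRepr_abs_farPressure_integrand_le hg1 ha hg0 hx y)
    _ = ENNReal.ofReal (4 / Real.pi) * ∫⁻ y, {y : E3 | a ≤ ‖y - 0‖}.indicator
          (fun y => ENNReal.ofReal ((‖y - 0‖ ^ 3)⁻¹ * ‖v y‖ ^ 2)) y := by
        rw [← lintegral_const_mul' _ _ ENNReal.ofReal_ne_top]
        refine lintegral_congr fun y => ?_
        by_cases hy : y ∈ {y : E3 | a ≤ ‖y - 0‖}
        · rw [indicator_of_mem hy, indicator_of_mem hy, ← ENNReal.ofReal_mul (by positivity)]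
        · rw [indicator_of_notMem hy, indicator_of_notMem hy, mul_zero, mul_zero,
            ENNReal.ofReal_zero]
    _ = ENNReal.ofReal (4 / Real.pi) *
          ∫⁻ y in {y : E3 | a ≤ ‖y - 0‖}, ENNReal.ofReal ((‖y - 0‖ ^ 3)⁻¹ * ‖v y‖ ^ 2) := by
        rw [lintegral_indicator hS]
    _ ≤ ENNReal.ofReal (4 / Real.pi) * ENNReal.ofReal (4 * I / a ^ 2) :=
        mul_le_mul_right hshell _
    _ = ENNReal.ofReal (16 * I / (Real.pi * a ^ 2)) := by
        rw [← ENNReal.ofReal_mul (by positivity)]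
        congr 1
        field_simp
        ring

/-- **Absolute convergence of the far-field pressure integral.** [folklore] -/
theorem pressureRepr_farPressure_integrable (hv : Continuous v) (hI : 0 ≤ I)
    (hMor : ∀ r > 0, ∫ y in ball (0 : E3) r, ‖v y‖ ^ 2 ≤ I * r) (hg : Continuous g)
    (hg1 : ∀ y, |g y| ≤ 1) (ha : 0 < a) (hg0 : ∀ y, ‖y‖ < a → g y = 0) (hx : 2 * ‖x‖ ≤ a) :
    Integrable (fun y => g y * pressureKernel (x - y) (v y)) := by
  refine ⟨pressureRepr_aestronglyMeasurable_farPressure_integrand hg hv x, ?_⟩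
  rw [hasFiniteIntegral_iff_enorm]
  exact lt_of_le_of_lt (pressureRepr_lintegral_farPressure_le hv hI hMor hg1 ha hg0 hx)
    ENNReal.ofReal_lt_top

/-- **The far-field pressure bound**: `|∫ g(y) K(x-y)(v y) dy| ≤ 16 I/(π a²)`. [folklore] -/
theorem pressureRepr_abs_farPressure_le (hv : Continuous v) (hI : 0 ≤ I)
    (hMor : ∀ r > 0, ∫ y in ball (0 : E3) r, ‖v y‖ ^ 2 ≤ I * r)
    (hg1 : ∀ y, |g y| ≤ 1) (ha : 0 < a) (hg0 : ∀ y, ‖y‖ < a → g y = 0) (hx : 2 * ‖x‖ ≤ a) :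
    |∫ y, g y * pressureKernel (x - y) (v y)| ≤ 16 * I / (Real.pi * a ^ 2) := by
  have h := pressureRepr_lintegral_farPressure_le hv hI hMor hg1 ha hg0 hx
  rw [← Real.norm_eq_abs]
  refine (norm_integral_le_lintegral_norm _).trans ?_
  have h' : ∫⁻ y, ENNReal.ofReal ‖g y * pressureKernel (x - y) (v y)‖ ≤
      ENNReal.ofReal (16 * I / (Real.pi * a ^ 2)) := by
    simpa only [ofReal_norm] using h
  exact ENNReal.toReal_le_of_le_ofReal (by positivity) h'

/-- **The far-field Riesz pressure of a field with scale-invariant energy** (closed form of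
`pressureRepr_farPressure_integrable` and `pressureRepr_abs_farPressure_le`): for `v` continuous with
`∫_{B(0,r)} ‖v‖² ≤ I r` (`r > 0`, `I ≥ 0`), a continuous weight `|g| ≤ 1` vanishing on `B(0,a)`
(`a > 0`) and `2‖x‖ ≤ a`, the integral `∫ g(y) K(x-y)(v y) dy` converges absolutely and is bounded by
`16 I/(π a²)`. [folklore] -/
theorem pressureRepr_farPressure_bound :
    ∀ {v : E3 → E3} {g : E3 → ℝ} {I a : ℝ} {x : E3}, Continuous v → 0 ≤ I →
      (∀ r > 0, ∫ y in ball (0 : E3) r, ‖v y‖ ^ 2 ≤ I * r) → Continuous g → (∀ y, |g y| ≤ 1) →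
      0 < a → (∀ y, ‖y‖ < a → g y = 0) → 2 * ‖x‖ ≤ a →
      Integrable (fun y => g y * pressureKernel (x - y) (v y)) ∧
        |∫ y, g y * pressureKernel (x - y) (v y)| ≤ 16 * I / (Real.pi * a ^ 2) :=
  fun hv hI hMor hg hg1 ha hg0 hx =>
    ⟨pressureRepr_farPressure_integrable hv hI hMor hg hg1 ha hg0 hx,
      pressureRepr_abs_farPressure_le hv hI hMor hg1 ha hg0 hx⟩

end FarPressure

/-! ### Locality of the quadratic source -/

/-- **The source `∂ᵢ∂ⱼ(vᵢvⱼ)` is a local operator**: it only depends on the germ of the field.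
[folklore] -/
theorem pressureRepr_pressureSource_congr {v w : E3 → E3} {y : E3} (h : v =ᶠ[𝓝 y] w) :
    pressureSource v y = pressureSource w y := by
  rw [pressureSource_def, pressureSource_def]
  set F : E3 → E3 := fun y' => convect v v y' + VectorCalculus.divergence v y' • v y' with hFdef
  set G : E3 → E3 := fun y' => convect w w y' + VectorCalculus.divergence w y' • w y' with hGdef
  have hFG : F =ᶠ[𝓝 y] G := by
    filter_upwards [eventually_eventuallyEq_nhds.2 h] with y' hy'
    have e1 : fderiv ℝ v y' = fderiv ℝ w y' := hy'.fderiv_eq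
    have e2 : v y' = w y' := hy'.eq_of_nhds
    simp only [hFdef, hGdef, convect_apply, VectorCalculus.divergence, e1, e2]
  show LinearMap.trace ℝ E3 (fderiv ℝ F y : E3 →ₗ[ℝ] E3) =
    LinearMap.trace ℝ E3 (fderiv ℝ G y : E3 →ₗ[ℝ] E3)
  rw [hFG.fderiv_eq]

end Summit.NavierStokesRegularity.NavierStokesRegularity.Theorems.ClockLaw.Birth

end
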